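import Mathlib
import Summits.ResolutionOfSingularities.ResolutionOfSingularities.Theorems.WeightedInvariantLocalWeightedDropNCResSettingHeadDropCurve

/-!
# `WeightedInvariant.LocalWeightedDrop`: NC-resolution settings for the TOT₂ line — A B-PERMISSIBLE CENTRE OF MAXIMAL DIMENSION
# (tangent space = directrix of the degree-`c` form) WINS THE HEAD PHASE IN ONE MOVE (every dimension, every field)

Crux item stmt-ResolutionOfSingularities-8899 `LocalWeightedDrop` (route `ResolutionOfSingularities/WeightedInvariant`), ENGINE skeleton v32,
residuals `stub_spaceNCRankDrop` (m = 2) and `stub_wildWideApexFourStartsWon` (W4|₄, m = 3, res-L1-w43-strat-1's line `directrix-cut`, v3 in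
preparation: regime `apexPlane₃` = apex dimension `e = 2` in four letters).  [OURS · L1 W4.3 · chain w43 · seat res-L1-w43-stub-4 gen 5; def-free;
on res-L1-w43-stub-1's S-SET (`Decoration`, `Admissible`, `IsBPermissible`, `dWinsTo_headDrop_of_orderDrop`) and res-L1-w43-stub-3's (N3)
(`TOT2Near.initEval_add_smul_eq_of_near_curve`); the count game is the programme's own; nothing here is a statement of any manuscript;
AI-produced, gate-checked, weaker than expert review.]

MODEL.  Cossart–Jannsen–Saito, LNM 2270, Thm 2.14: the points of the blow-up in a permissible centre `D ∋ x` that are near to `x` lie on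
`ℙ(Dir_x(X) / T_x(D))`; so when the centre has the dimension of the directrix (`T_x(D) = Dir_x(X)`) there is NO near point and the Hilbert–Samuel
head drops at every point over `x`.  res-L1-w43-stub-1's `dWinsTo_headDrop_of_apexLine_curve` (p538898) is the case `e ≤ 1` (a permissible curve
tangent to a one-dimensional directrix); this file removes the bound on `e`:
* `TOT2Near.order_slice_lt_of_dir_le_centre` — (N3) read at `T_x C = Dir`: for weights `w ∈ {0,1}^{n+1}`, a permissible `f` (`o ≤ weightedOrder_w f`)
  ALL of whose invariance vectors of `in_o f` are supported on the weight-`0` letters (the tangent letters of the centre) has NO near point over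
  the origin: at every exceptional point and live slot the sliced strict transform has order `< o`;
* **`dWinsTo_headDrop_of_dirInCentre`** — from an admissibly decorated position, a B-permissible move `(Φ, w)` such that every invariance vector
  of `in_c(Φ^* g)` (`g = f · ∏_{l ∈ O} x_l`, `c = ord g`) vanishes on the weight-`1` slots forces «admissibly decorated of smaller head» in ONE
  move (`DWinsTo Prod.fst`, the currency of `hhigh`);
* `dWinsTo_headDrop_of_inCentreIdeal` — the same from a LETTER-PRESERVING legal `Φ` and the permissibility inequality
  `c ≤ weightedOrder_w (Φ^* g)` (`isBPermissible_of_totalO_weightedOrder`);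
* `dWinsTo_headDrop_of_dirInCentre_indicator` — the same for a COORDINATE centre `V(x_j : j ∈ S)` in the position's own letters.
At `m = 3`, `e = 2` these are the one-move exits from a permissible smooth SURFACE germ tangent to the directrix plane that is normal crossing with
the boundary (the surface analogue of the `e = 1` curve move); at any `m` they also cover the `e = 1` curve move and the `e = 0` point move.
-/

set_option linter.dupNamespace false -- mandated namespace of this single-conjunct summit

noncomputable section

namespace Summit.ResolutionOfSingularities.ResolutionOfSingularities.Theorems

open Literature.AlgebraicGeometry.Resolution

namespace TOT2Near

open MvPowerSeries

variable {k : Type} [Field k] {n : ℕ}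

/-- **(N3) AT `T_x C = Dir`: NO NEAR POINT.**  Weights `w ∈ {0,1}^{n+1}`, chart convention `w_l = 0 → c_l = 0`, live slot `i₀`, `f` permissible
for the centre (`o ≤ weightedOrder_w f`).  If every translation-invariance vector of the degree-`o` form of `f` is supported on the weight-`0`
letters (the directrix is contained in — hence, by `initEval_add_eq_of_perm`, equal to — the tangent space of the centre), then at every
exceptional point over the origin the sliced strict transform has order `< o`: a near point `c` would be an invariance vector
(`initEval_add_smul_eq_of_near_curve`), hence supported on the weight-`0` letters, where the chart convention makes it vanish — but `c_{i₀} ≠ 0`.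
[OURS · L1 W4.3] -/
theorem order_slice_lt_of_dir_le_centre (w : Fin (n + 1) → ℕ) (c : Fin (n + 1) → k) (hw : ∀ l, w l ≤ 1)
    (hc0 : ∀ l, w l = 0 → c l = 0) (i₀ : Fin (n + 1)) (hc : c i₀ ≠ 0) (f : MvPowerSeries (Fin (n + 1)) k) {o : ℕ}
    (hperm : (o : ℕ∞) ≤ f.weightedOrder w)
    (hdir : ∀ u : Fin (n + 1) → k,
      (∀ v, CobordantChart.initEval (fun _ : Fin (n + 1) => 1) (v + u) o f = CobordantChart.initEval (fun _ : Fin (n + 1) => 1) v o f) →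
      ∀ l, w l ≠ 0 → u l = 0)
    {G : MvPowerSeries (Fin (n + 1 + 1)) k} (hfac : subst (CobordantChart.chart w c) f = X 0 ^ o * G) :
    (TupleGame.slice i₀ G).order < o := by
  by_contra hle
  rw [not_lt] at hle
  have hinv : ∀ v, CobordantChart.initEval (fun _ : Fin (n + 1) => 1) (v + c) o f =
      CobordantChart.initEval (fun _ : Fin (n + 1) => 1) v o f := fun v => by
    have h := initEval_add_smul_eq_of_near_curve w c hw hc0 i₀ hc f hperm hfac hle 1 v
    rwa [one_smul] at h
  by_cases hw0 : w i₀ = 0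
  · exact hc (hc0 _ hw0)
  · exact hc (hdir c hinv i₀ hw0)

end TOT2Near

namespace TameFourTupleDrop

open MvPowerSeries AxisPolyhedron

variable {k : Type} [Field k] {m : ℕ}

/-- **A B-PERMISSIBLE CENTRE OF MAXIMAL DIMENSION WINS THE HEAD PHASE IN ONE MOVE** (OURS · L1 W4.3; every `m`, every field, every apex
dimension `e`).  From an admissibly decorated position `(b, δ)`, a B-permissible move `(Φ, w)` such that every translation-invariance vector of the
degree-`c` form of `Φ^* g` (`g = f · ∏_{l ∈ O} x_l`, `c = ord g`, read in the move's coordinates where the centre is `V(x_l : w_l = 1)`) vanishes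
on the weight-`1` slots — i.e. the directrix of `in_c g` is (contained in, hence equal to) the tangent space of the centre — forces «admissibly
decorated of strictly smaller head» at every answer: `TOT2Near.order_slice_lt_of_dir_le_centre` on `Φ^* g` + S-SET part 12's
`dWinsTo_headDrop_of_orderDrop`.  Generalises `dWinsTo_headDrop_of_apexLine_curve` (p538898: `e ≤ 1`, any positive-dimensional centre). -/
theorem dWinsTo_headDrop_of_dirInCentre {b : MvPowerSeries (Fin (m + 1)) k} {δ : Decoration k m} (hadm : Admissible b δ)
    {Φ : Fin (m + 1) → MvPowerSeries (Fin (m + 1)) k} {w : Fin (m + 1) → ℕ} (hperm : IsBPermissible δ Φ w)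
    (hdir : ∀ u : Fin (m + 1) → k,
      (∀ v, CobordantChart.initEval (fun _ : Fin (m + 1) => 1) (v + u) δ.c (subst Φ (δ.f * ∏ l ∈ δ.O, X l)) =
        CobordantChart.initEval (fun _ : Fin (m + 1) => 1) v δ.c (subst Φ (δ.f * ∏ l ∈ δ.O, X l))) →
      ∀ l, w l ≠ 0 → u l = 0) :
    DWinsTo (St := MvPowerSeries (Fin (m + 1)) k × Decoration k m) Prod.fst
      (fun τ => Admissible τ.1 τ.2 ∧ τ.2.head < δ.head) (b, δ) := by
  have hmv : IsCountMove Φ w := hperm.1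
  have hP3 := hperm.2.2.2
  have hordΦ : (subst Φ (δ.f * ∏ l ∈ δ.O, X l)).order = (δ.c : ℕ∞) := Decoration.order_subst_totalO hadm hmv
  have hP1g : (δ.c : ℕ∞) ≤ (subst Φ (δ.f * ∏ l ∈ δ.O, X l)).weightedOrder w := by
    rw [← hordΦ]
    exact (isBPermissible_iff_totalO hmv hadm.2.1.ne_zero hP3).mp hperm
  refine dWinsTo_headDrop_of_orderDrop hadm hperm fun c hc hc0 A G hfac hG i hci => ?_
  obtain ⟨hA, -⟩ := Decoration.order_slice_totalO_eq hperm hc hadm.2.1.ne_zero hci hfac hG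
  subst hA
  exact TOT2Near.order_slice_lt_of_dir_le_centre w c hmv.2.2.1 hc i hci _ hP1g hdir hfac

/-- **THE SAME FROM A LETTER-PRESERVING WITNESS AND THE PERMISSIBILITY INEQUALITY** (OURS · L1 W4.3): a legal `Φ` straightening every boundary
letter (`Φ_l = u · x_{l'}`, `u(0) ≠ 0`, for `l ∈ E`), weights `w ∈ {0,1}^{m+1}` with some `w_l = 1`, `c ≤ weightedOrder_w (Φ^* g)` (the coordinate
centre `V(x_l : w_l = 1)` of the move's coordinates is permissible for `g`), and the directrix condition of `dWinsTo_headDrop_of_dirInCentre` give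
the head drop in one move (`isBPermissible_of_totalO_weightedOrder`).  At `m = 3`, `e = 2` this is the exit from a permissible smooth surface germ
tangent to the directrix plane and normal crossing with the boundary; the `e = 1` curve case is res-L1-w43-stub-1's `dWinsTo_headDrop_of_inAxisIdeal`. -/
theorem dWinsTo_headDrop_of_inCentreIdeal {b : MvPowerSeries (Fin (m + 1)) k} {δ : Decoration k m} (hadm : Admissible b δ)
    {Φ : Fin (m + 1) → MvPowerSeries (Fin (m + 1)) k} (hΦ0 : ∀ i, constantCoeff (Φ i) = 0)
    (hΦdet : IsUnit (Matrix.det (Matrix.of fun i j : Fin (m + 1) => coeff (Finsupp.single j 1) (Φ i))))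
    (hP3 : ∀ l ∈ δ.E, ∃ (l' : Fin (m + 1)) (u : MvPowerSeries (Fin (m + 1)) k), constantCoeff u ≠ 0 ∧ Φ l = u * X l')
    {w : Fin (m + 1) → ℕ} (hw : ∀ l, w l ≤ 1) (hwpos : ∃ l, 0 < w l)
    (hin : (δ.c : ℕ∞) ≤ (subst Φ (δ.f * ∏ l ∈ δ.O, X l)).weightedOrder w)
    (hdir : ∀ u : Fin (m + 1) → k,
      (∀ v, CobordantChart.initEval (fun _ : Fin (m + 1) => 1) (v + u) δ.c (subst Φ (δ.f * ∏ l ∈ δ.O, X l)) =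
        CobordantChart.initEval (fun _ : Fin (m + 1) => 1) v δ.c (subst Φ (δ.f * ∏ l ∈ δ.O, X l))) →
      ∀ l, w l ≠ 0 → u l = 0) :
    DWinsTo (St := MvPowerSeries (Fin (m + 1)) k × Decoration k m) Prod.fst
      (fun τ => Admissible τ.1 τ.2 ∧ τ.2.head < δ.head) (b, δ) := by
  have hmv : IsCountMove Φ w := ⟨hΦ0, hΦdet, hw, hwpos⟩
  exact dWinsTo_headDrop_of_dirInCentre hadm (isBPermissible_of_totalO_weightedOrder hadm hmv hP3 hin) hdir

/-- **THE SAME FOR A COORDINATE CENTRE IN THE POSITION'S OWN LETTERS** (OURS · L1 W4.3): if the coordinate subspace `V(x_j : j ∈ S)`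
(`S` non-empty) is permissible for `g = f · ∏_O x_l` (`c ≤ weightedOrder_{𝟙_S} g`) and every invariance vector of `in_c g` vanishes on `S`
(`Dir(in_c g) = V(x_j : j ∈ S)`'s tangent space), the identity move with weights `𝟙_S` is B-permissible and drops the head at every answer.
(`S = univ`: the point move at `e = 0`, res-L1-w43-stub-1's `dWinsTo_headDrop_of_apexTrivial`; `|S| = m`: the axis move at `e = 1`,
`dWinsTo_headDrop_of_apexLine_axis`; `|S| = m − 1`, `m = 3`: the SURFACE move at `e = 2`.) -/
theorem dWinsTo_headDrop_of_dirInCentre_indicator {b : MvPowerSeries (Fin (m + 1)) k} {δ : Decoration k m} (hadm : Admissible b δ)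
    {S : Finset (Fin (m + 1))} (hS : S.Nonempty)
    (hP1g : (δ.c : ℕ∞) ≤ (δ.f * ∏ l ∈ δ.O, X l).weightedOrder (fun j => if j ∈ S then 1 else 0))
    (hdir : ∀ u : Fin (m + 1) → k,
      (∀ v, CobordantChart.initEval (fun _ : Fin (m + 1) => 1) (v + u) δ.c (δ.f * ∏ l ∈ δ.O, X l) =
        CobordantChart.initEval (fun _ : Fin (m + 1) => 1) v δ.c (δ.f * ∏ l ∈ δ.O, X l)) →
      ∀ l ∈ S, u l = 0) :
    DWinsTo (St := MvPowerSeries (Fin (m + 1)) k × Decoration k m) Prod.fst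
      (fun τ => Admissible τ.1 τ.2 ∧ τ.2.head < δ.head) (b, δ) := by
  have hperm := isBPermissible_X_indicator_of_totalO hadm hS hP1g
  refine dWinsTo_headDrop_of_dirInCentre hadm hperm fun u hu l hl => ?_
  rw [show subst (fun j => (X j : MvPowerSeries (Fin (m + 1)) k)) (δ.f * ∏ l ∈ δ.O, X l) = δ.f * ∏ l ∈ δ.O, X l from
    congrFun subst_self _] at hu
  have hlS : l ∈ S := by
    by_contra hlS
    exact hl (if_neg hlS)
  exact hdir u hu l hlS

end TameFourTupleDrop

end Summit.ResolutionOfSingularities.ResolutionOfSingularities.Theorems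

end
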